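import Summits.QuantumFields.BalabanUV.Beta.GAN24.WrecAtSlotRows
import Summits.QuantumFields.BalabanUV.Beta.CombChartStepJets
import Summits.QuantumFields.BalabanUV.Beta.SymSecondOrderTablesAn1

/-!
# `BalabanUV.Beta.GAN24.CombSpureRowsOfSRows` — binder row G-an2-4 ∕ (CONV-C), TRANSFER-III: **«S′ FROM S» AT ROW D1's LITERAL OF RECORD (III′)** — the rows
# «S′Shape» ∧ «S′Drift» of the unit tables of the UNFOLDED comb-chart family `SpureCombOf tabs …` FROM the S-slot rows (hS, hSall) of the folded family `ScombOf tabs …`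
# (the (III′) ∕ slot twin of road-P2 g35's `WrecAtSlotRows` §1–§3 over leaf-03 g40's rooted Λ rows `StencilSlotLamRoot` ∕ `StencilSlotLamDriftRoot`, re-cut for a GENERIC
# field–field Hessian table `H`; the Λ piece reads the UNDRESSED resolvents `KInvStep` — chart-free — so road P1's landed unit K-pair `KSlotAssembly.convCKWall_holds` applies)
# (G-an2-4 CRUX TEAM (2), leaf prover `b2b-balaban-gan24-formalise-leaf-02`, gen 79; INTENT I-leaf02-g79-4)

NOT IN PRINT; OUR BOOKKEEPING ([folklore] kernel bookkeeping BY NAME; 0 `def`, 0 cited fact, 0 `def … : Prop`, 0 sorry).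
HONEST FRAMING (cell contract, verbatim): «discharging `BetaPertH` makes Bałaban's UV stability UNCONDITIONAL — a real constructive-QFT result; it is NOT the continuum
limit and NOT the Clay problem.»  HONEST DEPENDENCY (verbatim): «continuum YM on T⁴ ⇐ BetaPertH ∧ nine spine estimates (0/9 proved); BetaPertH ⇐ (D1) ∧ (D4) ∧ CAP+tail;
G-an2-4 gates asym, D1 and NE2/3/4.»

WHAT (generic `d`, `[NeZero Lc]`):
* §1 for ANY field–field-valued table `H` (block letters `hHfm hHmf hHmm`) with `hQ : VertexFamily H Lc CH (δ∕2)`: `unitS_lamPiece_eq_of_table` (the normalised Λ piece of member `j+1`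
  is `(cΛ·Lc^{2(d+1)}) • S^Λ` of the unit-normalised resolvents over `H`), **`locStencil_unitS_lamPiece_of_table`** (uniform row from `UnitDecayK`), **`locStencil_unitS_lamPiece_sub_of_table`**
  (drift row `· θ^k` from `UnitDecayK ∧ CauchyDecayK`) — leaf-03 g40's two proofs token for token with `hessFFAt (toSite r) ↦ H`, `biLoc_hessFFAt ↦ hQ`.
* §2 the peel for the SLOTTED family `SpureRecOf V H G … (j+1) = SrecOf … (j+1) − Λ-piece(H)` in units (`unitS_SpureRecOf_succ_eq`).
* §3 **`exists_hS_SpureRecOf_of_rows`** ∕ **`exists_hSall_SpureRecOf_of_rows`** (slots `V H G` under (LV)(LH)(DG), `H` field–field-valued; K undressed letters): «S′Shape» ∧ «S′Drift» of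
  `unitS_j (SpureRecOf V H G …)` ⟸ (hS, hSall) of `unitS_j (SrecOf V H G …)` — road-P2's §2 token for token.
* §4 `d = 3`, `2 ≤ Lc`, an1's record: **`exists_spureCombOf_rows_three_of_scombOf_rows`** — K by `convCKWall_holds`, `H := symHessFFAt ρ_c Lc` (an1's `vertexFamily_symHessFFAt`).
Asserts NO value of Bałaban's tables; discharges NO S-row; the (III′) campaign is NOT asked (an2 W-4) — typed while idle under R-gan24p1-g46-2; NEVER «G-an2-4 closed» as (CONV-C);
NOT D1, NOT `BetaPertH`, NOT continuum, NOT Clay.  2026-08-25; no existing file touched.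
-/

noncomputable section

open scoped BigOperators
open Literature.MathematicalPhysics.QuantumFieldTheory
open Literature.MathematicalPhysics.QuantumFieldTheory.Balaban1983to89
open Literature.MathematicalPhysics.QuantumFieldTheory.Balaban1983to89.Beta
open B12Sec2to5 (l1 l1_nonneg)
open ExpKernelCalculus (MKer Decays BiLoc VertexFamily Zl Zl_nonneg)
open OneStepResolventKernel (Fib LocStencil)
open OneStepKernelFamily (KInvStep)
open AffineAveraging (box toSite)
open AveragingContoursRooted (ctr ctrOff ctrOff_mem_box)
open InterLevelTransport (SLam locStencil_SLam)
open AveragingHessianKernels (ell)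
open BalabanStepJetsSucc (wΛ E2 lamCoeffK abs_lamCoeffK_le)
open Summit.QuantumFields.BalabanUV.Beta.HessKerDressedUnits (unitS unitS_sub)
open Summit.QuantumFields.BalabanUV.Beta.AxialDressingRooted (one_le_of_neZero)
open Summit.QuantumFields.BalabanUV.Beta.WardLocusRecursive (SrecOf)
open Summit.QuantumFields.BalabanUV.Beta.SpineRooted (SpureRecOf SrecOf_eq_SpureRecOf_add_lam_succ locStencil_SpureRecOf)
open Summit.QuantumFields.BalabanUV.Beta.SymmetrisedStepJets (SymTables)
open Summit.QuantumFields.BalabanUV.Beta.SymAveragingHessianCounts (symHessFFAt symHessFFAt_inl_inr symHessFFAt_inr vertexFamily_symHessFFAt)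
open Summit.QuantumFields.BalabanUV.Beta.CombChartStepJets (GcombSh decays_GcombSh ScombOf SpureCombOf ScombOf_eq SpureCombOf_eq)
open Summit.QuantumFields.BalabanUV.Beta.SymSecondOrderTablesAn1 (symTablesAn1S2)
open Summit.QuantumFields.BalabanUV.Beta.GAN24.CombesThomas (sfStep smStep sfStep_ne_zero smStep_ne_zero KStepUnit UnitDecayK CauchyDecayK)
open Summit.QuantumFields.BalabanUV.Beta.GAN24.KSlotAssembly (convCKWall_holds)
open Summit.QuantumFields.BalabanUV.Beta.GAN24.StencilSlotOfShapes (locStencil_mono' unitS_step_zero)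
open Summit.QuantumFields.BalabanUV.Beta.GAN24.StencilSlotCauchyOfShapes (locStencil_sub)
open Summit.QuantumFields.BalabanUV.Beta.GAN24.StencilSlotLam (SLam_entry_zero SLam_smul unitS_smul_ffOnly lamCoeffK_unit E2_inr decays_E2unit lam_unit_factor)
open Summit.QuantumFields.BalabanUV.Beta.GAN24.StencilSlotLamDrift (SLam_sub abs_lamCoeff_sub_le)

namespace Summit.QuantumFields.BalabanUV.Beta.GAN24.CombSpureRowsOfSRows

variable {d : ℕ} {Lc : ℕ} [NeZero Lc]

/-! ## §1 The normalised Λ piece over a GENERIC field–field Hessian table: closed form, uniform row, drift row -/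

section Table

variable (H : Fin (d + 1) → (Fin (d + 1) → ℤ) → MKer (d + 1) (Fib d))
  (hHfm : ∀ μ y x z (α ν : Fin (d + 1)), H μ y x z (Sum.inl α) (Sum.inr ν) = 0)
  (hHmf : ∀ μ y x z (ν α : Fin (d + 1)), H μ y x z (Sum.inr ν) (Sum.inl α) = 0)
  (hHmm : ∀ μ y x z (ν ν' : Fin (d + 1)), H μ y x z (Sum.inr ν) (Sum.inr ν') = 0)
include hHfm hHmf hHmm

/-- [folklore] **THE NORMALISED Λ PIECE OF MEMBER `j + 1` OVER `H`** is `(cΛ·Lc^{2(d+1)}) • S^Λ` with coefficients `lamCoeffK (KStepUnit Lc (j+1)) ((s_m j)² • E2 d Lc (j+1)) Lc`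
(leaf-03 g40's `unitS_lamPiece_eq` with the table a LETTER: `lamCoeffK_unit`, `SLam_smul`, `unitS_smul_ffOnly`, `lam_unit_factor` BY NAME). -/
theorem unitS_lamPiece_eq_of_table (cΛ : ℝ) (j : ℕ) :
    unitS (sfStep Lc (j + 1)) (smStep d Lc (j + 1))
        (fun κ u => (cΛ * wΛ d Lc (j + 1)) • SLam Lc (lamCoeffK (KInvStep (d := d) Lc (j + 1)) (E2 d Lc (j + 1)) Lc) H κ u)
      = fun κ u => (cΛ * (Lc : ℝ) ^ (2 * (d + 1))) •
          SLam Lc (lamCoeffK (KStepUnit (d := d) Lc (j + 1)) ((smStep d Lc j) ^ 2 • E2 d Lc (j + 1)) Lc) H κ u := by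
  have hsf : sfStep Lc (j + 1) ≠ 0 := sfStep_ne_zero (j + 1)
  have hsm : smStep d Lc (j + 1) ≠ 0 := smStep_ne_zero (d := d) (j + 1)
  have ht : (smStep d Lc j) ^ 2 ≠ 0 := pow_ne_zero 2 (smStep_ne_zero (d := d) j)
  have hc : lamCoeffK (KInvStep (d := d) Lc (j + 1)) (E2 d Lc (j + 1)) Lc = fun μ y κ u =>
      ((smStep d Lc (j + 1) * sfStep Lc (j + 1))⁻¹ * ((smStep d Lc j) ^ 2)⁻¹) *
        lamCoeffK (KStepUnit (d := d) Lc (j + 1)) ((smStep d Lc j) ^ 2 • E2 d Lc (j + 1)) Lc μ y κ u := by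
    funext μ y κ u
    exact lamCoeffK_unit hsf hsm ht _ _ (fun y z ν b => E2_inr (j + 1) y z ν b) Lc μ y κ u
  rw [hc, SLam_smul]
  have hfun : (fun κ u => (cΛ * wΛ d Lc (j + 1)) •
      (fun κ u => ((smStep d Lc (j + 1) * sfStep Lc (j + 1))⁻¹ * ((smStep d Lc j) ^ 2)⁻¹) •
        SLam Lc (lamCoeffK (KStepUnit (d := d) Lc (j + 1)) ((smStep d Lc j) ^ 2 • E2 d Lc (j + 1)) Lc) H κ u) κ u)
      = fun κ u => ((cΛ * wΛ d Lc (j + 1)) * (((smStep d Lc (j + 1) * sfStep Lc (j + 1))⁻¹ * ((smStep d Lc j) ^ 2)⁻¹))) •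
        SLam Lc (lamCoeffK (KStepUnit (d := d) Lc (j + 1)) ((smStep d Lc j) ^ 2 • E2 d Lc (j + 1)) Lc) H κ u := by
    funext κ u
    rw [smul_smul]
  rw [hfun, unitS_smul_ffOnly _ _ _ _ (fun κ u x y α ν => SLam_entry_zero _ (fun μ y' => hHfm μ y' x y α ν) κ u)
    (fun κ u x y ν α => SLam_entry_zero _ (fun μ y' => hHmf μ y' x y ν α) κ u) (fun κ u x y ν ν' => SLam_entry_zero _ (fun μ y' => hHmm μ y' x y ν ν') κ u)]
  funext κ u
  congr 1
  rw [← mul_assoc]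
  exact lam_unit_factor cΛ j

omit hHfm hHmf hHmm in
/-- [folklore] **UNIFORM ROW OF THE NORMALISED Λ PIECE OVER `H`, FROM THE K-SLOT's DECAY HALF** (`UnitDecayK … C δ`, `0 < δ`, `hQ : VertexFamily H Lc CH (δ∕2)`):
every member `j + 1` is a local stencil family with ONE `j`-free constant and rate `δ∕4` (leaf-03 g40's `locStencil_unitS_lamPiece` with the table a letter). -/
theorem locStencil_unitS_lamPiece_of_table
    (hHfm : ∀ μ y x z (α ν : Fin (d + 1)), H μ y x z (Sum.inl α) (Sum.inr ν) = 0)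
    (hHmf : ∀ μ y x z (ν α : Fin (d + 1)), H μ y x z (Sum.inr ν) (Sum.inl α) = 0)
    (hHmm : ∀ μ y x z (ν ν' : Fin (d + 1)), H μ y x z (Sum.inr ν) (Sum.inr ν') = 0)
    {C δ CH : ℝ} (hK : UnitDecayK d Lc (sfStep Lc) (smStep d Lc) C δ) (hδ : 0 < δ) (hQ : VertexFamily H Lc CH (δ / 2))
    (cΛ : ℝ) (j : ℕ) :
    LocStencil (unitS (sfStep Lc (j + 1)) (smStep d Lc (j + 1))
        (fun κ u => (cΛ * wΛ d Lc (j + 1)) • SLam Lc (lamCoeffK (KInvStep (d := d) Lc (j + 1)) (E2 d Lc (j + 1)) Lc) H κ u))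
      (|cΛ * (Lc : ℝ) ^ (2 * (d + 1))| * ((d + 1 : ℕ) * (((Fintype.card (Fib d) : ℝ) * (C * C) * Zl (d + 1) (δ - δ / 2)) * CH * Zl (d + 1) (δ / 2 / 2))))
      (δ / 2 / 2) := by
  rw [unitS_lamPiece_eq_of_table H hHfm hHmf hHmm]
  have hA : Decays (KStepUnit (d := d) Lc (j + 1)) C δ := hK (j + 1)
  have hE : Decays ((smStep d Lc j) ^ 2 • E2 d Lc (j + 1)) C δ := decays_E2unit (hK j) hδ.le
  have hC : 0 ≤ C := hA.nonneg (Sum.inl 0)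
  have hc := abs_lamCoeffK_le hA hE hδ Lc
  have hS := locStencil_SLam (N := Lc) hc hQ (by positivity) (mul_nonneg (mul_nonneg (Nat.cast_nonneg _) (mul_nonneg hC hC)) (Zl_nonneg (by linarith)))
  exact StepJetData.locStencil_smul _ hS

omit hHfm hHmf hHmm in
/-- [folklore] **DRIFT ROW OF THE NORMALISED Λ PIECE OVER `H`** (`UnitDecayK … C δ`, `CauchyDecayK … cK θ δ`, `0 < δ`, `0 ≤ θ`, `hQ`): the difference of members
`k+j+1` and `k+1` is a local stencil family with constant `(…)·θ^k` and rate `δ∕4` (leaf-03 g40's `locStencil_unitS_lamPiece_sub` with the table a letter). -/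
theorem locStencil_unitS_lamPiece_sub_of_table
    (hHfm : ∀ μ y x z (α ν : Fin (d + 1)), H μ y x z (Sum.inl α) (Sum.inr ν) = 0)
    (hHmf : ∀ μ y x z (ν α : Fin (d + 1)), H μ y x z (Sum.inr ν) (Sum.inl α) = 0)
    (hHmm : ∀ μ y x z (ν ν' : Fin (d + 1)), H μ y x z (Sum.inr ν) (Sum.inr ν') = 0)
    {C cK θ δ CH : ℝ} (hK : UnitDecayK d Lc (sfStep Lc) (smStep d Lc) C δ) (hKall : CauchyDecayK d Lc (sfStep Lc) (smStep d Lc) cK θ δ)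
    (hδ : 0 < δ) (hθ : 0 ≤ θ) (hQ : VertexFamily H Lc CH (δ / 2)) (cΛ : ℝ) (k j : ℕ) :
    LocStencil
      (fun κ u => unitS (sfStep Lc (k + j + 1)) (smStep d Lc (k + j + 1))
          (fun κ u => (cΛ * wΛ d Lc (k + j + 1)) • SLam Lc (lamCoeffK (KInvStep (d := d) Lc (k + j + 1)) (E2 d Lc (k + j + 1)) Lc) H κ u) κ u -
        unitS (sfStep Lc (k + 1)) (smStep d Lc (k + 1))
          (fun κ u => (cΛ * wΛ d Lc (k + 1)) • SLam Lc (lamCoeffK (KInvStep (d := d) Lc (k + 1)) (E2 d Lc (k + 1)) Lc) H κ u) κ u)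
      ((|cΛ * (Lc : ℝ) ^ (2 * (d + 1))| * ((d + 1 : ℕ) * (((Fintype.card (Fib d) : ℝ) * (cK * θ * C + C * cK) * Zl (d + 1) (δ - δ / 2)) * CH * Zl (d + 1) (δ / 2 / 2)))) *
        θ ^ k)
      (δ / 2 / 2) := by
  rw [unitS_lamPiece_eq_of_table H hHfm hHmf hHmm, unitS_lamPiece_eq_of_table H hHfm hHmf hHmm]
  have hC : 0 ≤ C := (hK 0).nonneg (Sum.inl 0)
  have hcK : 0 ≤ cK := by
    have h := (hKall 0 0).nonneg (Sum.inl 0)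
    simpa using h
  set c₁ := lamCoeffK (KStepUnit (d := d) Lc (k + j + 1)) ((smStep d Lc (k + j)) ^ 2 • E2 d Lc (k + j + 1)) Lc with hc₁def
  set c₂ := lamCoeffK (KStepUnit (d := d) Lc (k + 1)) ((smStep d Lc k) ^ 2 • E2 d Lc (k + 1)) Lc with hc₂def
  have hZ : 0 ≤ Zl (d + 1) (δ - δ / 2) := Zl_nonneg (by linarith)
  have hc₁ : ∀ μ y κ u, |c₁ μ y κ u| ≤ ((Fintype.card (Fib d) : ℝ) * (C * C) * Zl (d + 1) (δ - δ / 2)) * Real.exp (-(δ / 2) * l1 ((Lc : ℤ) • y - u)) :=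
    abs_lamCoeffK_le (hK (k + j + 1)) (decays_E2unit (hK (k + j)) hδ.le) hδ Lc
  have hc₂ : ∀ μ y κ u, |c₂ μ y κ u| ≤ ((Fintype.card (Fib d) : ℝ) * (C * C) * Zl (d + 1) (δ - δ / 2)) * Real.exp (-(δ / 2) * l1 ((Lc : ℤ) • y - u)) :=
    abs_lamCoeffK_le (hK (k + 1)) (decays_E2unit (hK k) hδ.le) hδ Lc
  have hCC : 0 ≤ (Fintype.card (Fib d) : ℝ) * (C * C) * Zl (d + 1) (δ - δ / 2) := by positivity
  set Cd : ℝ := ((Fintype.card (Fib d) : ℝ) * (cK * θ * C + C * cK) * Zl (d + 1) (δ - δ / 2)) * θ ^ k with hCd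
  have hCd0 : 0 ≤ Cd := by positivity
  have hdiff : ∀ μ y κ u, |c₁ μ y κ u - c₂ μ y κ u| ≤ Cd * Real.exp (-(δ / 2) * l1 ((Lc : ℤ) • y - u)) := by
    intro μ y κ u
    refine (abs_lamCoeff_sub_le hK hKall hδ k j μ y κ u).trans (le_of_eq ?_)
    rw [hCd]
    ring
  have hS := locStencil_SLam (N := Lc) (c := fun μ y κ u => c₁ μ y κ u - c₂ μ y κ u) hdiff hQ (by positivity) hCd0
  intro κ u x z a b
  have hlin := SLam_sub (N := Lc) hc₁ hc₂ hQ (by positivity) hCC hCC κ u x z a b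
  have hb := hS κ u x z a b
  simp only [Pi.sub_apply, Pi.smul_apply, smul_eq_mul]
  rw [← mul_sub, hlin, abs_mul]
  refine (mul_le_mul_of_nonneg_left hb (abs_nonneg _)).trans (le_of_eq ?_)
  rw [hCd]
  ring

end Table

/-! ## §2 The peel for the slotted family: the unfolded tables are the folded ones minus the Λ piece -/

section Peel

variable (V H : Fin (d + 1) → (Fin (d + 1) → ℤ) → MKer (d + 1) (Fib d)) (G : ℕ → MKer (d + 1) (Fib d)) (cE cVH cΛ : ℝ)

/-- [folklore] `SpureRecOf (j+1) = SrecOf (j+1) − Λ_{j+1}(H)` as table families (`SrecOf_eq_SpureRecOf_add_lam_succ`, rearranged). -/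
theorem SpureRecOf_succ_eq_sub (j : ℕ) :
    SpureRecOf d Lc V H G cE cVH cΛ (j + 1) = SrecOf d Lc V H G cE cVH cΛ (j + 1) -
      fun κ' u' => (cΛ * wΛ d Lc (j + 1)) • SLam Lc (lamCoeffK (KInvStep (d := d) Lc (j + 1)) (E2 d Lc (j + 1)) Lc) H κ' u' := by
  funext κ' u'
  rw [Pi.sub_apply, Pi.sub_apply, SrecOf_eq_SpureRecOf_add_lam_succ V H G cE cVH cΛ j κ' u', add_sub_cancel_right]

/-- [folklore] THE PEEL IN UNITS: `unitS sf sm (SpureRecOf (j+1)) = unitS sf sm (SrecOf (j+1)) − unitS sf sm Λ_{j+1}(H)` (`unitS_sub`). -/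
theorem unitS_SpureRecOf_succ_eq (sf sm : ℝ) (j : ℕ) :
    unitS sf sm (SpureRecOf d Lc V H G cE cVH cΛ (j + 1)) = unitS sf sm (SrecOf d Lc V H G cE cVH cΛ (j + 1)) -
      unitS sf sm (fun κ' u' => (cΛ * wΛ d Lc (j + 1)) • SLam Lc (lamCoeffK (KInvStep (d := d) Lc (j + 1)) (E2 d Lc (j + 1)) Lc) H κ' u') := by
  rw [SpureRecOf_succ_eq_sub, unitS_sub]

end Peel

/-! ## §3 «S′Shape» and «S′Drift» of the slotted unfolded family from the folded family's rows and the undressed K-slot -/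

section Rows

variable (V H : Fin (d + 1) → (Fin (d + 1) → ℤ) → MKer (d + 1) (Fib d)) (G : ℕ → MKer (d + 1) (Fib d))
  (hV : ∀ δ : ℝ, 0 ≤ δ → ∃ C : ℝ, LocStencil V C δ) (hH : ∀ δ : ℝ, 0 ≤ δ → ∃ C : ℝ, VertexFamily H Lc C δ)
  (hG : ∀ j : ℕ, ∃ δ C : ℝ, 0 < δ ∧ 0 ≤ C ∧ Decays (G j) C δ)
  (hHfm : ∀ μ y x z (α ν : Fin (d + 1)), H μ y x z (Sum.inl α) (Sum.inr ν) = 0)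
  (hHmf : ∀ μ y x z (ν α : Fin (d + 1)), H μ y x z (Sum.inr ν) (Sum.inl α) = 0)
  (hHmm : ∀ μ y x z (ν ν' : Fin (d + 1)), H μ y x z (Sum.inr ν) (Sum.inr ν') = 0)
include hV hH hG hHfm hHmf hHmm

/-- NOT IN PRINT; OUR BOOKKEEPING — A SOCKET ([folklore] assembly; generic `d`, slots `V H G` under (LV)(LH)(DG), `H` field–field-valued).  **«S′Shape»: THE UNIFORM UNIT ROW OF
`SpureRecOf V H G …` FROM THE FOLDED FAMILY's UNIFORM ROW `hS` AND THE UNDRESSED K-SLOT's DECAY HALF** — members `≥ 1` by the peel (§2) and §1's Λ row; member `0` is one fixed local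
table (`locStencil_SpureRecOf … 0`, unit `1`).  One constant, one rate (road-P2's `exists_hS_SpureRecAt_of_rows` over the slots). -/
theorem exists_hS_SpureRecOf_of_rows {C δ : ℝ} (hK : UnitDecayK d Lc (sfStep Lc) (smStep d Lc) C δ) (hδ : 0 < δ) (cE cVH cΛ : ℝ) {Cs δS : ℝ}
    (hS : ∀ j, LocStencil (unitS (sfStep Lc j) (smStep d Lc j) (SrecOf d Lc V H G cE cVH cΛ j)) Cs δS) (hδS : 0 < δS) :
    ∃ Cs' δs' : ℝ, 0 < δs' ∧ ∀ j, LocStencil (unitS (sfStep Lc j) (smStep d Lc j) (SpureRecOf d Lc V H G cE cVH cΛ j)) Cs' δs' := by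
  have hLc : 1 ≤ Lc := one_le_of_neZero Lc
  obtain ⟨C₀, δ₀, hδ₀, h0⟩ := locStencil_SpureRecOf (d := d) (Lc := Lc) hLc hV hH hG cE cVH cΛ 0
  have hδ2 : (0 : ℝ) ≤ δ / 2 := by positivity
  obtain ⟨CH, hQ⟩ := hH (δ / 2) hδ2
  have hCH : 0 ≤ CH := (hQ 0 0).nonneg (Sum.inl 0)
  have hΛ := fun j => locStencil_unitS_lamPiece_of_table H hHfm hHmf hHmm hK hδ hQ cΛ j
  set CΛ : ℝ := |cΛ * (Lc : ℝ) ^ (2 * (d + 1))| *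
    ((d + 1 : ℕ) * (((Fintype.card (Fib d) : ℝ) * (C * C) * Zl (d + 1) (δ - δ / 2)) * CH * Zl (d + 1) (δ / 2 / 2))) with hCΛ_def
  have hCΛ : 0 ≤ CΛ := ((hΛ 0) 0 0).nonneg (Sum.inl 0)
  set m : ℝ := min δ₀ (min δS (δ / 2 / 2)) with hm_def
  have hm0 : 0 < m := lt_min hδ₀ (lt_min hδS (by positivity))
  have hm₀ : m ≤ δ₀ := min_le_left _ _
  have hmS : m ≤ δS := (min_le_right _ _).trans (min_le_left _ _)
  have hmΛ : m ≤ δ / 2 / 2 := (min_le_right _ _).trans (min_le_right _ _)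
  refine ⟨max C₀ (Cs + CΛ), m, hm0, fun j => ?_⟩
  cases j with
  | zero =>
      rw [unitS_step_zero]
      exact locStencil_mono' h0 (le_max_left _ _) hm₀
  | succ j =>
      rw [unitS_SpureRecOf_succ_eq]
      exact locStencil_mono' (locStencil_sub (locStencil_mono' (hS (j + 1)) le_rfl hmS) (locStencil_mono' (hΛ j) le_rfl hmΛ))
        (le_max_right _ _) le_rfl

/-- NOT IN PRINT; OUR BOOKKEEPING — A SOCKET ([folklore] assembly; generic `d`, slots as in §3).  **«S′Drift»: THE ALL-SCALES CAUCHY UNIT ROW OF `SpureRecOf V H G …` FROM THE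
FOLDED FAMILY's ROWS (hS, hSall) AND THE UNDRESSED K-SLOT** — pairs `(k+1+j, k+1)` by the peel, `sub_sub_sub_comm`, the folded Cauchy row and §1's Λ drift row (ratio `θK`);
pairs `(j, 0)` by the uniform row twice; ONE ratio `θ′ = max (max θK θS) ½ < 1` (road-P2's `exists_hSall_SpureRecAt_of_rows` over the slots). -/
theorem exists_hSall_SpureRecOf_of_rows {C cK θK δ : ℝ} (hK : UnitDecayK d Lc (sfStep Lc) (smStep d Lc) C δ)
    (hKall : CauchyDecayK d Lc (sfStep Lc) (smStep d Lc) cK θK δ) (hδ : 0 < δ) (hθK0 : 0 ≤ θK) (hθK1 : θK < 1) (cE cVH cΛ : ℝ) {Cs cS θS δS : ℝ}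
    (hS : ∀ j, LocStencil (unitS (sfStep Lc j) (smStep d Lc j) (SrecOf d Lc V H G cE cVH cΛ j)) Cs δS)
    (hSall : ∀ k j, LocStencil (unitS (sfStep Lc (k + j)) (smStep d Lc (k + j)) (SrecOf d Lc V H G cE cVH cΛ (k + j)) -
      unitS (sfStep Lc k) (smStep d Lc k) (SrecOf d Lc V H G cE cVH cΛ k)) (cS * θS ^ k) δS)
    (hδS : 0 < δS) (hθS0 : 0 ≤ θS) (hθS1 : θS < 1) :
    ∃ Cs' cS' θ' δ' : ℝ, 0 ≤ θ' ∧ θ' < 1 ∧ 0 < δ' ∧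
      (∀ j, LocStencil (unitS (sfStep Lc j) (smStep d Lc j) (SpureRecOf d Lc V H G cE cVH cΛ j)) Cs' δ') ∧
      (∀ k j, LocStencil (unitS (sfStep Lc (k + j)) (smStep d Lc (k + j)) (SpureRecOf d Lc V H G cE cVH cΛ (k + j)) -
        unitS (sfStep Lc k) (smStep d Lc k) (SpureRecOf d Lc V H G cE cVH cΛ k)) (cS' * θ' ^ k) δ') := by
  obtain ⟨Cs', δ₁, hδ₁, hS'⟩ := exists_hS_SpureRecOf_of_rows V H G hV hH hG hHfm hHmf hHmm hK hδ cE cVH cΛ hS hδS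
  have hCs' : 0 ≤ Cs' := ((hS' 0) 0 0).nonneg (Sum.inl 0)
  have hcS : 0 ≤ cS := by have h := ((hSall 0 0) 0 0).nonneg (Sum.inl 0); simpa using h
  have hδ2 : (0 : ℝ) ≤ δ / 2 := by positivity
  obtain ⟨CH, hQ⟩ := hH (δ / 2) hδ2
  have hCH : 0 ≤ CH := (hQ 0 0).nonneg (Sum.inl 0)
  have hΛd := fun k j => locStencil_unitS_lamPiece_sub_of_table H hHfm hHmf hHmm hK hKall hδ hθK0 hQ cΛ k j
  set CΛd : ℝ := |cΛ * (Lc : ℝ) ^ (2 * (d + 1))| *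
    ((d + 1 : ℕ) * (((Fintype.card (Fib d) : ℝ) * (cK * θK * C + C * cK) * Zl (d + 1) (δ - δ / 2)) * CH * Zl (d + 1) (δ / 2 / 2))) with hCΛd_def
  have hCΛd : 0 ≤ CΛd := by have h := ((hΛd 0 0) 0 0).nonneg (Sum.inl 0); simpa using h
  set θ' : ℝ := max (max θK θS) (1 / 2) with hθ'_def
  have hθ'0 : 0 ≤ θ' := hθK0.trans ((le_max_left _ _).trans (le_max_left _ _))
  have hθ'1 : θ' < 1 := max_lt (max_lt hθK1 hθS1) (by norm_num)
  have hKθ : θK ≤ θ' := (le_max_left _ _).trans (le_max_left _ _)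
  have hSθ : θS ≤ θ' := (le_max_right _ _).trans (le_max_left _ _)
  set m : ℝ := min δ₁ (min δS (δ / 2 / 2)) with hm_def
  have hm0 : 0 < m := lt_min hδ₁ (lt_min hδS (by positivity))
  have hm₁ : m ≤ δ₁ := min_le_left _ _
  have hmS : m ≤ δS := (min_le_right _ _).trans (min_le_left _ _)
  have hmΛ : m ≤ δ / 2 / 2 := (min_le_right _ _).trans (min_le_right _ _)
  refine ⟨Cs', max (Cs' + Cs') (cS + 2 * CΛd), θ', m, hθ'0, hθ'1, hm0, fun j => locStencil_mono' (hS' j) le_rfl hm₁, fun k j => ?_⟩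
  cases k with
  | zero =>
      have h := locStencil_sub (locStencil_mono' (hS' (0 + j)) le_rfl hm₁) (locStencil_mono' (hS' 0) le_rfl hm₁)
      refine locStencil_mono' h ?_ le_rfl
      rw [pow_zero, mul_one]
      exact le_max_left _ _
  | succ k =>
      have e : k + 1 + j = k + j + 1 := by omega
      rw [e, unitS_SpureRecOf_succ_eq, unitS_SpureRecOf_succ_eq, sub_sub_sub_comm]
      have hSS : LocStencil (unitS (sfStep Lc (k + j + 1)) (smStep d Lc (k + j + 1)) (SrecOf d Lc V H G cE cVH cΛ (k + j + 1)) -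
          unitS (sfStep Lc (k + 1)) (smStep d Lc (k + 1)) (SrecOf d Lc V H G cE cVH cΛ (k + 1))) (cS * θ' ^ (k + 1)) m := by
        have h := hSall (k + 1) j
        rw [e] at h
        exact locStencil_mono' h (mul_le_mul_of_nonneg_left (pow_le_pow_left₀ hθS0 hSθ (k + 1)) hcS) hmS
      have hΛΛ : LocStencil
          (unitS (sfStep Lc (k + j + 1)) (smStep d Lc (k + j + 1))
              (fun κ' u' => (cΛ * wΛ d Lc (k + j + 1)) • SLam Lc (lamCoeffK (KInvStep (d := d) Lc (k + j + 1)) (E2 d Lc (k + j + 1)) Lc) H κ' u') -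
            unitS (sfStep Lc (k + 1)) (smStep d Lc (k + 1))
              (fun κ' u' => (cΛ * wΛ d Lc (k + 1)) • SLam Lc (lamCoeffK (KInvStep (d := d) Lc (k + 1)) (E2 d Lc (k + 1)) Lc) H κ' u'))
          ((2 * CΛd) * θ' ^ (k + 1)) m := by
        have hθk : θK ^ k ≤ θ' ^ k := pow_le_pow_left₀ hθK0 hKθ k
        have hbound : CΛd * θK ^ k ≤ (2 * CΛd) * θ' ^ (k + 1) := by
          have h1 : CΛd * θK ^ k ≤ CΛd * θ' ^ k := mul_le_mul_of_nonneg_left hθk hCΛd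
          have h2 : CΛd * θ' ^ k ≤ (2 * CΛd) * θ' ^ (k + 1) := by
            have hhalf : (1 / 2 : ℝ) ≤ θ' := le_max_right _ _
            rw [pow_succ]
            nlinarith [mul_nonneg hCΛd (pow_nonneg hθ'0 k)]
          exact h1.trans h2
        exact locStencil_mono' (hΛd k j) hbound hmΛ
      refine locStencil_mono' (locStencil_sub hSS hΛΛ) ?_ le_rfl
      calc cS * θ' ^ (k + 1) + 2 * CΛd * θ' ^ (k + 1) = (cS + 2 * CΛd) * θ' ^ (k + 1) := by ring
        _ ≤ max (Cs' + Cs') (cS + 2 * CΛd) * θ' ^ (k + 1) := mul_le_mul_of_nonneg_right (le_max_right _ _) (pow_nonneg hθ'0 _)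

end Rows

/-! ## §4 `d = 3`, `2 ≤ Lc`, an1's record: the K-slot and the table letters DISCHARGED -/

/-- NOT IN PRINT; OUR BOOKKEEPING — A SOCKET ([folklore] assembly; `d = 3`, `2 ≤ Lc`, every `cΛt cE cVH cΛ`).  **«S′Shape» ∧ «S′Drift» OF `unitS_j (SpureCombOf (symTablesAn1S2 3 Lc cΛt) …)`
FROM THE S-SLOT ROWS (hS, hSall) OF `unitS_j (ScombOf (symTablesAn1S2 3 Lc cΛt) …)` ALONE** — road P1's unit K-pair `KSlotAssembly.convCKWall_holds` (TREE, hypothesis-free; the Λ piece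
reads the UNDRESSED `KInvStep`) supplies `UnitDecayK ∕ CauchyDecayK`; the record's slots `symVhSAt ρ_c ∕ symHessFFAt ρ_c ∕ GcombSh` meet (LV)(LH)(DG) and the block letters BY NAME. -/
theorem exists_spureCombOf_rows_three_of_scombOf_rows (hLc : 2 ≤ Lc) (cΛt cE cVH cΛ : ℝ) {Cs cS θS δS : ℝ}
    (hS : ∀ j, LocStencil (unitS (sfStep Lc j) (smStep 3 Lc j) (ScombOf (symTablesAn1S2 3 Lc cΛt) cE cVH cΛ j)) Cs δS)
    (hSall : ∀ k j, LocStencil (unitS (sfStep Lc (k + j)) (smStep 3 Lc (k + j)) (ScombOf (symTablesAn1S2 3 Lc cΛt) cE cVH cΛ (k + j)) -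
      unitS (sfStep Lc k) (smStep 3 Lc k) (ScombOf (symTablesAn1S2 3 Lc cΛt) cE cVH cΛ k)) (cS * θS ^ k) δS)
    (hδS : 0 < δS) (hθS0 : 0 ≤ θS) (hθS1 : θS < 1) :
    ∃ Cs' cS' θ' δ' : ℝ, 0 ≤ θ' ∧ θ' < 1 ∧ 0 < δ' ∧
      (∀ j, LocStencil (unitS (sfStep Lc j) (smStep 3 Lc j) (SpureCombOf (symTablesAn1S2 3 Lc cΛt) cE cVH cΛ j)) Cs' δ') ∧
      (∀ k j, LocStencil (unitS (sfStep Lc (k + j)) (smStep 3 Lc (k + j)) (SpureCombOf (symTablesAn1S2 3 Lc cΛt) cE cVH cΛ (k + j)) -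
        unitS (sfStep Lc k) (smStep 3 Lc k) (SpureCombOf (symTablesAn1S2 3 Lc cΛt) cE cVH cΛ k)) (cS' * θ' ^ k) δ') := by
  obtain ⟨C, δK, cK, θK, hδK, hθK0, hθK1, hK, hKall⟩ := convCKWall_holds (Lc := Lc) hLc
  rw [SpureCombOf_eq]
  rw [ScombOf_eq] at hS hSall
  exact exists_hSall_SpureRecOf_of_rows (symTablesAn1S2 3 Lc cΛt).V (symTablesAn1S2 3 Lc cΛt).H (GcombSh (d := 3) Lc) (symTablesAn1S2 3 Lc cΛt).hV
    (symTablesAn1S2 3 Lc cΛt).hH (decays_GcombSh (d := 3) Lc) (fun μ y x z α ν => symHessFFAt_inl_inr (ctr (3 + 1) Lc) Lc μ y x z α ν)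
    (fun μ y x z ν α => symHessFFAt_inr (ctr (3 + 1) Lc) Lc μ y x z ν (Sum.inl α)) (fun μ y x z ν ν' => symHessFFAt_inr (ctr (3 + 1) Lc) Lc μ y x z ν (Sum.inr ν'))
    hK hKall hδK hθK0 hθK1 cE cVH cΛ hS hSall hδS hθS0 hθS1

end Summit.QuantumFields.BalabanUV.Beta.GAN24.CombSpureRowsOfSRows

end
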